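import Literature.Probability.RandomPlanarGeometry.ChordalUniformizerConvergence
import Summits.CriticalPhenomena.SAWScalingLimit.Theorems.SAWTensorRGRestrictionOfLimitSqueezeChart
import Mathlib.Topology.ContinuousMap.Basic
import HarnessLib

/-!
# Outer squeezes with convergent boundary loops carry convergent closed-disc uniformizers (Radó)

Support file (`--supports stmt-CriticalPhenomena-0773`, towards the registered stub `stub_radoSqueezeFamily`,
geometry F′ of composition 3 of the line `birth` for the crux `RestrictionOfLimit`). No probability.

**Statement** (`exists_discUniformizers_of_tendstoUniformly_boundary`). Let `D' ` be a Dobrushin domain with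
marked points `a, b` and `E : ℝ → DobrushinDomain` a family with `D' ⊆ E t`, `(E t).pt 0 = a`, `(E t).pt 1 = b`
for `t > 0`, whose boundary loops converge uniformly to that of `D'` as `t → 0⁺`. Then there are continuous
maps `Φt t, Φ : ℂ → ℂ` agreeing on the open unit disc with conformal equivalences onto `E t`, `D'`, sending
`-1 ↦ a`, `1 ↦ b`, with `Φt t → Φ` uniformly on the closed unit disc as `t → 0⁺`.

**Proof.** Fix `z₀ ∈ D'`. For each `t` take a chordal uniformizing map `φ_t : ℍ → E t` normalised by
`‖φ_t⁻¹ z₀‖ = 1` (tree: `exists_isChordalUniformizing_norm_symm_eq_one`), and `φ` for `D'` likewise; let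
`Ψ_t`, `Ψ` be the Carathéodory extensions to the closed disc of `φ_t ∘ C⁻¹`, `φ ∘ C⁻¹` (`C` the Cayley map,
`C 0 = -1`, `C ∞ = 1`; tree: `JordanDomain.exists_continuousOn_extension_holds`), composed with the radial
retraction of `ℂ` onto the closed disc. The chordal boundary values give `Ψ_t (-1) = a`, `Ψ_t 1 = b`. Along
every sequence `t_n → 0⁺` the boundary extensions of `φ_{t_n}` converge to that of `φ` uniformly on the closed
half-plane (tree: `tendstoUniformlyOn_boundaryExtension_of_tendstoUniformly_boundary`, Radó's theorem,
Pommerenke (1992) Thm. 2.11); since `Ψ_t = φ_t^ext ∘ C⁻¹` on the closed disc minus `1` and `Ψ_t 1 = b = Ψ 1`,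
`Ψ_{t_n} → Ψ` uniformly on the closed disc, and the sequential characterisation of `𝓝[>] 0` concludes.

References: Ch. Pommerenke, *Boundary Behaviour of Conformal Maps* (1992), Thm. 2.6, Thm. 2.11. Axioms
`propext`, `Classical.choice`, `Quot.sound`; named facts only through discharged `_holds` theorems.
-/

noncomputable section

open Set Filter Topology Metric Complex
open UpperHalfPlane (upperHalfPlaneSet)
open Literature.Probability.RandomPlanarGeometry

namespace Summit.CriticalPhenomena.SAWScalingLimit.Theorems.RestrictionOfLimit.Birth

/-! ### The radial retraction onto the closed unit disc -/

/-- **A continuous retraction of `ℂ` onto the closed unit disc** (`z ↦ z / max 1 ‖z‖`). [folklore] -/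
theorem exists_discRetract : ∃ ρ : C(ℂ, ℂ), (∀ z : ℂ, ‖ρ z‖ ≤ 1) ∧ ∀ z : ℂ, ‖z‖ ≤ 1 → ρ z = z := by
  have h : Continuous fun z : ℂ ↦ max (1 : ℝ) ‖z‖ := continuous_const.max continuous_norm
  have hpos : ∀ z : ℂ, 0 < max (1 : ℝ) ‖z‖ := fun z ↦ lt_of_lt_of_le zero_lt_one (le_max_left _ _)
  have h' : Continuous fun z : ℂ ↦ (max (1 : ℝ) ‖z‖)⁻¹ := h.inv₀ fun z ↦ (hpos z).ne'
  refine ⟨⟨fun z ↦ ((max 1 ‖z‖)⁻¹ : ℝ) • z, h'.smul continuous_id⟩, fun z ↦ ?_, fun z hz ↦ ?_⟩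
  · show ‖((max 1 ‖z‖)⁻¹ : ℝ) • z‖ ≤ 1
    rw [norm_smul, Real.norm_of_nonneg (inv_nonneg.2 (hpos z).le), inv_mul_le_iff₀ (hpos z), mul_one]
    exact le_max_right _ _
  · show ((max 1 ‖z‖)⁻¹ : ℝ) • z = z
    rw [max_eq_left hz, inv_one, one_smul]

/-! ### Closed-disc uniformizers attached to chordal uniformizing maps -/

/-- **Closed-disc uniformizer of a chordal uniformizing map.** For a chordal uniformizing map `φ` of
`(W; a, b)` there is a continuous `Ψ : ℂ → ℂ` agreeing with the conformal equivalence `φ ∘ C⁻¹` on the open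
disc, with `Ψ (-1) = a`, `Ψ 1 = b`, and `Ψ (C z) = φ^ext z` on the closed half-plane. [folklore] -/
theorem exists_discUniformizer (W : DobrushinDomain) (φ : ConformalEquiv upperHalfPlaneSet W.carrier)
    (hφ : W.IsChordalUniformizing φ) :
    ∃ Ψ : C(ℂ, ℂ), EqOn Ψ (cayley.symm.trans φ) (ball (0 : ℂ) 1) ∧ Ψ (-1) = W.pt 0 ∧ Ψ 1 = W.pt 1 ∧
      ∀ z : ℂ, 0 ≤ z.im → Ψ (cayleyFun z) = φ.boundaryExtension z := by
  obtain ⟨Ψ₀, hΨc, hΨeq, -, -⟩ :=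
    JordanDomain.exists_continuousOn_extension_holds W.toJordanDomain (cayley.symm.trans φ)
  haveI : NeBot (𝓝[upperHalfPlaneSet] (0 : ℂ)) := neBot_nhdsWithin_upperHalfPlaneSet_zero
  haveI : NeBot (cocompact ℂ ⊓ 𝓟 upperHalfPlaneSet) := neBot_cocompact_inf_principal_upperHalfPlaneSet
  obtain ⟨ρ, hρ1, hρeq⟩ := exists_discRetract
  have hcont : Continuous fun z ↦ Ψ₀ (ρ z) :=
    hΨc.comp_continuous ρ.continuous fun z ↦ mem_closedBall_zero_iff.2 (hρ1 z)
  refine ⟨⟨fun z ↦ Ψ₀ (ρ z), hcont⟩, fun z hz ↦ ?_, ?_, ?_, fun z hz ↦ ?_⟩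
  · show Ψ₀ (ρ z) = _
    rw [hρeq z (mem_ball_zero_iff.1 hz).le]
    exact hΨeq hz
  · show Ψ₀ (ρ (-1)) = _
    rw [hρeq (-1) (by simp), ← cayleyFun_zero]
    have h1 := JordanDomain.tendsto_nhdsWithin_of_extension φ hΨc hΨeq (x := 0) le_rfl
    exact tendsto_nhds_unique h1 hφ.1
  · show Ψ₀ (ρ 1) = _
    rw [hρeq 1 (by simp)]
    exact tendsto_nhds_unique (JordanDomain.tendsto_cocompact_of_extension φ hΨc hΨeq) hφ.2
  · show Ψ₀ (ρ (cayleyFun z)) = _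
    rw [hρeq _ (norm_cayleyFun_le_one hz)]
    exact (JordanDomain.boundaryExtension_eq_of_extension φ hΨc hΨeq hz).symm

/-! ### The theorem -/

/-- **Convergent boundary loops give convergent closed-disc uniformizers** (Radó's theorem through the
chordal packaging of the tree). See the module docstring. [cite: PommerenkeBBCM1992, Thm. 2.11] -/
theorem exists_discUniformizers_of_tendstoUniformly_boundary {D' : DobrushinDomain} {a b : ℂ}
    (h0 : D'.pt 0 = a) (h1 : D'.pt 1 = b) (E : ℝ → DobrushinDomain)
    (hE : ∀ t : ℝ, 0 < t → D'.carrier ⊆ (E t).carrier ∧ (E t).pt 0 = a ∧ (E t).pt 1 = b)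
    (hEb : TendstoUniformly (fun t ↦ (E t).boundary) D'.boundary (𝓝[>] 0)) :
    ∃ (Φt : ℝ → C(ℂ, ℂ)) (Φ : C(ℂ, ℂ)),
      (∀ t : ℝ, 0 < t → ∃ g : ConformalEquiv (Metric.ball (0 : ℂ) 1) (E t).carrier,
        Set.EqOn (Φt t) g (Metric.ball (0 : ℂ) 1)) ∧
      (∃ g : ConformalEquiv (Metric.ball (0 : ℂ) 1) D'.carrier, Set.EqOn Φ g (Metric.ball (0 : ℂ) 1)) ∧
      (∀ t : ℝ, 0 < t → (E t).pt 0 = Φt t (-1) ∧ (E t).pt 1 = Φt t 1) ∧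
      D'.pt 0 = Φ (-1) ∧ D'.pt 1 = Φ 1 ∧
      TendstoUniformlyOn (fun t => ((Φt t : C(ℂ, ℂ)) : ℂ → ℂ)) (Φ : ℂ → ℂ) (𝓝[>] (0 : ℝ))
        (Metric.closedBall (0 : ℂ) 1) := by
  classical
  obtain ⟨z₀, hz₀⟩ := D'.nonempty
  -- normalised chordal uniformizing maps
  obtain ⟨φ, hφ, hφ1⟩ := MarkedDomain.exists_isChordalUniformizing_norm_symm_eq_one D' hz₀
  have hgood : ∀ t : ℝ, ∃ ψ : ConformalEquiv upperHalfPlaneSet (E t).carrier,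
      (E t).IsChordalUniformizing ψ ∧ (0 < t → ‖ψ.symm z₀‖ = 1) := by
    intro t
    by_cases ht : 0 < t
    · obtain ⟨ψ, hψ, hψ1⟩ :=
        MarkedDomain.exists_isChordalUniformizing_norm_symm_eq_one (E t) ((hE t ht).1 hz₀)
      exact ⟨ψ, hψ, fun _ ↦ hψ1⟩
    · obtain ⟨ψ, hψ⟩ := MarkedDomain.exists_isChordalUniformizing_holds (E t)
      exact ⟨ψ, hψ, fun h ↦ (ht h).elim⟩
  choose φs hφs hφs1 using hgood
  -- closed-disc uniformizers
  obtain ⟨Ψ, hΨeq, hΨa, hΨb, hΨext⟩ := exists_discUniformizer D' φ hφ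
  choose Ψs hΨseq hΨsa hΨsb hΨsext using fun t ↦ exists_discUniformizer (E t) (φs t) (hφs t)
  refine ⟨Ψs, Ψ, fun t _ ↦ ⟨_, hΨseq t⟩, ⟨_, hΨeq⟩, fun t _ ↦ ⟨(hΨsa t).symm, (hΨsb t).symm⟩,
    hΨa.symm, hΨb.symm, ?_⟩
  -- uniform convergence on the closed disc, along sequences
  rw [tendstoUniformlyOn_iff_seq_tendstoUniformlyOn]
  intro u hu
  -- replace the finitely many nonpositive terms
  set u' : ℕ → ℝ := fun n ↦ if 0 < u n then u n else 1 with hu'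
  have hu'pos : ∀ n, 0 < u' n := fun n ↦ by
    simp only [hu']
    split_ifs with h
    · exact h
    · exact one_pos
  have hev : ∀ᶠ n in atTop, u' n = u n := by
    have : ∀ᶠ n in atTop, u n ∈ Ioi (0 : ℝ) := hu.eventually (eventually_mem_nhdsWithin)
    filter_upwards [this] with n hn
    simp only [hu', if_pos (show 0 < u n from hn)]
  have hu't : Tendsto u' atTop (𝓝[>] 0) := hu.congr' (hev.mono fun n hn ↦ hn.symm)
  -- Radó along the sequence `u'`
  have hJ : TendstoUniformly (fun n ↦ (E (u' n)).boundary) D'.boundary atTop :=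
    (tendstoUniformly_iff_seq_tendstoUniformly.1 hEb) u' hu't
  have ha : Tendsto (fun n ↦ (E (u' n)).pt 0) atTop (𝓝 (D'.pt 0)) := by
    rw [h0]; exact tendsto_const_nhds.congr fun n ↦ ((hE _ (hu'pos n)).2.1).symm
  have hb : Tendsto (fun n ↦ (E (u' n)).pt 1) atTop (𝓝 (D'.pt 1)) := by
    rw [h1]; exact tendsto_const_nhds.congr fun n ↦ ((hE _ (hu'pos n)).2.2).symm
  obtain ⟨hU1, -⟩ := MarkedDomain.tendstoUniformlyOn_boundaryExtension_of_tendstoUniformly_boundary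
    (Ds := fun n ↦ E (u' n)) hJ ha hb hz₀ (fun n ↦ (hE _ (hu'pos n)).1 hz₀) φ hφ hφ1
    (fun n ↦ φs (u' n)) (fun n ↦ hφs (u' n)) (fun n ↦ hφs1 (u' n) (hu'pos n))
  rw [Metric.tendstoUniformlyOn_iff] at hU1 ⊢
  intro ε hε
  filter_upwards [hU1 ε hε, hev] with n hn hn' x hx
  rw [← hn']
  have hx1 : ‖x‖ ≤ 1 := mem_closedBall_zero_iff.1 hx
  by_cases hx' : x = 1
  · subst hx'
    rw [show (Ψ : ℂ → ℂ) 1 = b from hΨb.trans h1,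
      show (Ψs (u' n) : ℂ → ℂ) 1 = b from (hΨsb _).trans (hE _ (hu'pos n)).2.2, dist_self]
    exact hε
  · set y : ℂ := cayleyInvFun x with hy
    have hyim : 0 ≤ y.im := cayleyInvFun_im_nonneg hx1
    have hxy : cayleyFun y = x := cayleyFun_cayleyInvFun hx'
    have e1 : (Ψ : ℂ → ℂ) x = φ.boundaryExtension y := by rw [← hxy]; exact hΨext y hyim
    have e2 : (Ψs (u' n) : ℂ → ℂ) x = (φs (u' n)).boundaryExtension y := by
      rw [← hxy]; exact hΨsext _ y hyim
    rw [e1, e2]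
    exact hn y hyim

/-- **Registered helper stub `stub_radoSqueezeUniformizers`** (towards `stub_radoSqueezeFamily`, line `birth`):
`exists_discUniformizers_of_tendstoUniformly_boundary` in closed form. [cite: PommerenkeBBCM1992, Thm. 2.11] -/
theorem stub_radoSqueezeUniformizers :
    ∀ (D' : DobrushinDomain) (a b : ℂ), D'.pt 0 = a → D'.pt 1 = b → ∀ E : ℝ → DobrushinDomain,
      (∀ t : ℝ, 0 < t → D'.carrier ⊆ (E t).carrier ∧ (E t).pt 0 = a ∧ (E t).pt 1 = b) →
      TendstoUniformly (fun t => (E t).boundary) D'.boundary (𝓝[>] (0 : ℝ)) →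
      ∃ (Φt : ℝ → C(ℂ, ℂ)) (Φ : C(ℂ, ℂ)),
        (∀ t : ℝ, 0 < t → ∃ g : ConformalEquiv (Metric.ball (0 : ℂ) 1) (E t).carrier,
          Set.EqOn (Φt t) g (Metric.ball (0 : ℂ) 1)) ∧
        (∃ g : ConformalEquiv (Metric.ball (0 : ℂ) 1) D'.carrier, Set.EqOn Φ g (Metric.ball (0 : ℂ) 1)) ∧
        (∀ t : ℝ, 0 < t → (E t).pt 0 = Φt t (-1) ∧ (E t).pt 1 = Φt t 1) ∧
        D'.pt 0 = Φ (-1) ∧ D'.pt 1 = Φ 1 ∧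
        TendstoUniformlyOn (fun t => ((Φt t : C(ℂ, ℂ)) : ℂ → ℂ)) (Φ : ℂ → ℂ) (𝓝[>] (0 : ℝ))
          (Metric.closedBall (0 : ℂ) 1) :=
  fun _ _ _ h0 h1 E hE hEb ↦ exists_discUniformizers_of_tendstoUniformly_boundary h0 h1 E hE hEb

end Summit.CriticalPhenomena.SAWScalingLimit.Theorems.RestrictionOfLimit.Birth

end
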